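import Summits.NavierStokesRegularity.NavierStokesRegularity.Theorems.SqueezeCycleSingularZoomData
import HarnessLib

/-!
# The two-sided zooms of a classical solution on sup-controlled windows
# (crux `TypeIliouvilleNoTypeII`, stmt-NavierStokesRegularity-0056, line `Sketch`, stub
# `stub_activeWindowsGenerateNonconstant`)

Helper file (theorems only). For `ν > 0`, `T > 0`, a classical solution `(u, p)` of
Navier–Stokes on `ℝ³ × [0, T)`, Leray–Hopf from its rapidly decaying datum, a level `M > 0`, a
centre `(t₀, x₀)` and the viscosity-normalising parabolic zoom
`w(s, y) = M⁻¹ u(t₀ + ν s/M², x₀ + ν y/M)` (`windowZoom`; length `ν/M`, time `ν/M²`, amplitude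
`M`, so that `w` has unit viscosity and `|w| ≤ 1` wherever `|u| ≤ M`):

* `windowZoom_isClassical` — `w` is a classical unit-viscosity solution on every rescaled time
  window `(-k, k)` whose physical image `[t₀ - kν/M², t₀ + kν/M²]` lies in `(0, T)`
  (Leray's similarity, `IsClassicalNSSolutionOn.stRescale`); hence jointly continuous with weakly
  divergence-free slices there (`windowZoom_continuousOn`, `windowZoom_isWeaklyDivFree`);
* `windowZoom_oseen` — the Oseen integral equation `w(τ) = e^{(τ−σ)Δ}w(σ) − B¹_σ(w, w)(τ)` between
  all rescaled times of the window (the tree's `oseen_eq_timeRescale_of_classical` transported by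
  `oseen_smul_stPull`);
* `windowZoom_norm_le_one` — `|w| ≤ 1` on the window if `|u| ≤ M` on its physical image;
* `fderiv_windowZoom_zero` — `∇w(0)(0) = (ν/M²) ∇u(t₀)(x₀)`, so a gradient-active centre
  `ε M² ≤ ν‖∇u(t₀, x₀)‖` gives `ε ≤ ‖∇w(0, 0)‖` (`le_norm_fderiv_windowZoom_zero`).
-/

noncomputable section

-- the summit and its single problem share the name (D-0017 nested layout)
set_option linter.dupNamespace false

open MeasureTheory Set Function Filter TopologicalSpace Metric
open scoped Topology NNReal ENNReal

namespace Summit.NavierStokesRegularity.NavierStokesRegularity.Theorems.TypeIliouvilleNoTypeII.ImmortalZoom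

open Literature.Analysis Literature.Analysis.FluidPDE
open Summit.NavierStokesRegularity.NavierStokesRegularity.Theorems

variable {ν T M t₀ : ℝ} {u : ℝ → EuclideanSpace ℝ (Fin 3) → EuclideanSpace ℝ (Fin 3)} {p : ℝ → EuclideanSpace ℝ (Fin 3) → ℝ} {x₀ : EuclideanSpace ℝ (Fin 3)}

/-- Physical times of the rescaled window: if `[t₀ - kν/M², t₀ + kν/M²] ⊆ (0, T)` and `-k < s < k`
then `t₀ + (ν/M²) s ∈ (0, T)`. [folklore] -/
theorem windowZoom_time_mem (hν : 0 < ν) (hM : 0 < M) {k : ℝ}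
    (hsub : Icc (t₀ - k * ν / M ^ 2) (t₀ + k * ν / M ^ 2) ⊆ Ioo 0 T) {s : ℝ} (hs : s ∈ Ioo (-k) k) :
    t₀ + ν / M ^ 2 * s ∈ Ioo 0 T := by
  have hc : 0 < ν / M ^ 2 := by positivity
  refine hsub ⟨?_, ?_⟩
  · have h := mul_lt_mul_of_pos_left hs.1 hc
    have e : ν / M ^ 2 * -k = -(k * ν / M ^ 2) := by ring
    linarith [e]
  · have h := mul_lt_mul_of_pos_left hs.2 hc
    have e : ν / M ^ 2 * k = k * ν / M ^ 2 := by ring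
    linarith [e]

/-- **The window zoom is a classical unit-viscosity solution on the rescaled window** `(-k, k)`
(Leray's similarity transformation `IsClassicalNSSolutionOn.stRescale` with amplitude `M⁻¹`,
length `ν/M`, time `ν/M²`). [cite: Leray1934, §20] -/
theorem windowZoom_isClassical (hν : 0 < ν) (hsol : IsClassicalNSSolutionOn (Ico 0 T) ν 0 u p)
    (hM : 0 < M) {k : ℝ} (hsub : Icc (t₀ - k * ν / M ^ 2) (t₀ + k * ν / M ^ 2) ⊆ Ioo 0 T) :
    IsClassicalNSSolutionOn (Ioo (-k) k) 1 0 (M⁻¹ • stPull (ν / M ^ 2) (ν / M) t₀ x₀ u)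
      (M⁻¹ ^ 2 • stPull (ν / M ^ 2) (ν / M) t₀ x₀ p) := by
  have hM0 : M ≠ 0 := hM.ne'
  have hβ : ν / M ^ 2 = M⁻¹ * (ν / M) := by field_simp
  have key := hsol.stRescale (inv_pos.2 hM) (div_pos hν hM) hβ t₀ x₀
  have hvisc : M⁻¹ * ν / (ν / M) = 1 := by field_simp
  rw [hvisc, smul_stPull_zero] at key
  refine key.mono (fun s hs => ?_) isOpen_Ioo.uniqueDiffOn
  exact Ioo_subset_Ico_self (windowZoom_time_mem hν hM hsub hs)

/-- The window zoom is jointly continuous on its rescaled window. [folklore] -/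
theorem windowZoom_continuousOn (hν : 0 < ν) (hsol : IsClassicalNSSolutionOn (Ico 0 T) ν 0 u p)
    (hM : 0 < M) {k : ℝ} (hsub : Icc (t₀ - k * ν / M ^ 2) (t₀ + k * ν / M ^ 2) ⊆ Ioo 0 T) :
    ContinuousOn (uncurry (M⁻¹ • stPull (ν / M ^ 2) (ν / M) t₀ x₀ u)) (Ioo (-k) k ×ˢ univ) :=
  (windowZoom_isClassical (x₀ := x₀) hν hsol hM hsub).smooth_velocity.continuousOn

/-- The slices of the window zoom on its rescaled window are weakly divergence free (they are
`C¹` and divergence free). [folklore] -/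
theorem windowZoom_isWeaklyDivFree (hν : 0 < ν) (hsol : IsClassicalNSSolutionOn (Ico 0 T) ν 0 u p)
    (hM : 0 < M) {k : ℝ} (hsub : Icc (t₀ - k * ν / M ^ 2) (t₀ + k * ν / M ^ 2) ⊆ Ioo 0 T) {s : ℝ}
    (hs : s ∈ Ioo (-k) k) :
    IsWeaklyDivFree ((M⁻¹ • stPull (ν / M ^ 2) (ν / M) t₀ x₀ u) s) := by
  have h := windowZoom_isClassical (x₀ := x₀) hν hsol hM hsub
  exact VectorCalculus.IsDivFree.isWeaklyDivFree_holds (h.divFree s hs)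
    ((h.contDiff_velocity hs).of_le (by exact_mod_cast le_top))

/-- **The bound of the window zoom**: `|w| ≤ 1` on the rescaled window if `|u| ≤ M` on its physical
image. [folklore] -/
theorem windowZoom_norm_le_one (hν : 0 < ν) (hM : 0 < M) {k : ℝ}
    (hbd : ∀ t ∈ Icc (t₀ - k * ν / M ^ 2) (t₀ + k * ν / M ^ 2), ∀ x, ‖u t x‖ ≤ M) {s : ℝ}
    (hs : s ∈ Ioo (-k) k) (y : EuclideanSpace ℝ (Fin 3)) :
    ‖(M⁻¹ • stPull (ν / M ^ 2) (ν / M) t₀ x₀ u) s y‖ ≤ 1 := by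
  have hc : 0 < ν / M ^ 2 := by positivity
  have hmem : t₀ + ν / M ^ 2 * s ∈ Icc (t₀ - k * ν / M ^ 2) (t₀ + k * ν / M ^ 2) := by
    refine ⟨?_, ?_⟩
    · have h := mul_lt_mul_of_pos_left hs.1 hc
      have e : ν / M ^ 2 * -k = -(k * ν / M ^ 2) := by ring
      linarith [e]
    · have h := mul_lt_mul_of_pos_left hs.2 hc
      have e : ν / M ^ 2 * k = k * ν / M ^ 2 := by ring
      linarith [e]
  rw [smul_stPull_apply, norm_smul, Real.norm_eq_abs, abs_of_pos (inv_pos.2 hM)]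
  have h := hbd _ hmem (x₀ + (ν / M) • y)
  calc M⁻¹ * ‖u (t₀ + ν / M ^ 2 * s) (x₀ + (ν / M) • y)‖ ≤ M⁻¹ * M :=
        mul_le_mul_of_nonneg_left h (inv_pos.2 hM).le
    _ = 1 := inv_mul_cancel₀ hM.ne'

/-- **The window zoom in terms of the viscosity-normalised field** `ũ = timeRescale ν⁻¹ ν⁻¹ u`,
`ũ(s, x) = ν⁻¹u(s/ν, x)`: `M⁻¹ • u ∘ Φ = c • stPull (c²) c (ν t₀) x₀ ũ` with `c = ν/M`. [folklore] -/
theorem windowZoom_eq_smul_stPull_timeRescale (hν : 0 < ν) (hM : 0 < M) :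
    (M⁻¹ • stPull (ν / M ^ 2) (ν / M) t₀ x₀ u) =
      (ν / M) • stPull ((ν / M) ^ 2) (ν / M) (ν * t₀) x₀ (timeRescale ν⁻¹ ν⁻¹ u) := by
  have hν0 : ν ≠ 0 := hν.ne'
  have hM0 : M ≠ 0 := hM.ne'
  funext s y
  rw [smul_stPull_apply, smul_stPull_apply, timeRescale_apply, smul_smul]
  congr 1
  · field_simp
  · congr 1
    field_simp

/-- **The Oseen integral equation of the window zoom** between rescaled times `σ < τ` whose
physical images lie in `(0, T)` (KNSS 2009, §1 (1.2): mildness is scale invariant; the tree's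
`oseen_eq_timeRescale_of_classical` transported by `oseen_smul_stPull`). [cite: KochNadirashviliSereginSverak2009, §1 (1.2) and proof of Thm 6.2 (arXiv p. 13)] -/
theorem windowZoom_oseen (hν : 0 < ν) (hT : 0 < T) (hsol : IsClassicalNSSolutionOn (Ico 0 T) ν 0 u p)
    (hLH : IsLerayHopfOn T ν 0 (u 0) u) (h₀ : HasRapidSpatialDecay (u 0)) (hM : 0 < M) {σ τ : ℝ}
    (hσ : 0 < t₀ + ν / M ^ 2 * σ) (hστ : σ < τ) (hτ : t₀ + ν / M ^ 2 * τ < T) (y : EuclideanSpace ℝ (Fin 3)) :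
    (M⁻¹ • stPull (ν / M ^ 2) (ν / M) t₀ x₀ u) τ y =
      UnboundedOperators.heatExtension ((M⁻¹ • stPull (ν / M ^ 2) (ν / M) t₀ x₀ u) σ) (τ - σ) y -
        oseenDuhamel 1 σ (M⁻¹ • stPull (ν / M ^ 2) (ν / M) t₀ x₀ u)
          (M⁻¹ • stPull (ν / M ^ 2) (ν / M) t₀ x₀ u) τ y := by
  have hν0 : ν ≠ 0 := hν.ne'
  have hM0 : M ≠ 0 := hM.ne'
  have hc : 0 < ν / M := div_pos hν hM
  -- the physical times of `σ` and `τ` at unit viscosity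
  have e : ∀ r : ℝ, ν * t₀ + (ν / M) ^ 2 * r = ν * (t₀ + ν / M ^ 2 * r) := fun r => by
    field_simp
  have hσ' : 0 < ν * t₀ + (ν / M) ^ 2 * σ := by rw [e]; exact mul_pos hν hσ
  have hτ' : ν * t₀ + (ν / M) ^ 2 * τ < ν * T := by rw [e]; exact mul_lt_mul_of_pos_left hτ hν
  have hστ' : ν * t₀ + (ν / M) ^ 2 * σ < ν * t₀ + (ν / M) ^ 2 * τ := by
    have := mul_lt_mul_of_pos_left hστ (show 0 < (ν / M) ^ 2 by positivity)
    linarith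
  rw [windowZoom_eq_smul_stPull_timeRescale (t₀ := t₀) (x₀ := x₀) (u := u) hν hM]
  exact oseen_smul_stPull hc (ν * t₀) x₀ hστ (fun X =>
    oseen_eq_timeRescale_of_classical hν hT hsol hLH h₀ hσ' hστ' hτ' X) y

/-- **The gradient of the window zoom at the centre**: `∇w(0)(0) = (ν/M²) ∇u(t₀)(x₀)` (two chain
rules; `u(t₀)` differentiable). [folklore] -/
theorem fderiv_windowZoom_zero (hM : 0 < M) (hd : Differentiable ℝ (u t₀)) :
    fderiv ℝ ((M⁻¹ • stPull (ν / M ^ 2) (ν / M) t₀ x₀ u) 0) 0 = (ν / M ^ 2) • fderiv ℝ (u t₀) x₀ := by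
  have hM0 : M ≠ 0 := hM.ne'
  have hslice : (M⁻¹ • stPull (ν / M ^ 2) (ν / M) t₀ x₀ u) 0 =
      fun y => M⁻¹ • stPull (ν / M ^ 2) (ν / M) t₀ x₀ u 0 y := rfl
  have hd0 : Differentiable ℝ (u (t₀ + ν / M ^ 2 * 0)) := by rwa [mul_zero, add_zero]
  have hds : Differentiable ℝ (stPull (ν / M ^ 2) (ν / M) t₀ x₀ u 0) := differentiable_stPull_slice hd0
  rw [hslice, fderiv_fun_const_smul (hds 0), fderiv_stPull, mul_zero, add_zero, smul_zero, add_zero,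
    smul_smul]
  congr 1
  field_simp

/-- **A gradient-active centre survives the zoom**: if `ε M² ≤ ν ‖∇u(t₀, x₀)‖` then
`ε ≤ ‖∇w(0, 0)‖`. [folklore] -/
theorem le_norm_fderiv_windowZoom_zero (hν : 0 < ν) (hM : 0 < M) (hd : Differentiable ℝ (u t₀))
    {ε : ℝ} (hact : ε * M ^ 2 ≤ ν * ‖fderiv ℝ (u t₀) x₀‖) :
    ε ≤ ‖fderiv ℝ ((M⁻¹ • stPull (ν / M ^ 2) (ν / M) t₀ x₀ u) 0) 0‖ := by
  have hM2 : 0 < M ^ 2 := by positivity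
  rw [fderiv_windowZoom_zero hM hd, norm_smul, Real.norm_eq_abs, abs_of_pos (div_pos hν hM2)]
  rw [div_mul_eq_mul_div, le_div_iff₀ hM2]
  exact hact

/-! ### Registered tools stub -/

/-- **Registered tools stub of the line `Sketch` (crux `TypeIliouvilleNoTypeII`,
stmt-NavierStokesRegularity-0056)**: the conjunction of this file's exported lemmas on the window
zoom `w = M⁻¹ • stPull (ν/M²) (ν/M) t₀ x₀ u` — physical times of the rescaled window, joint
continuity, weak divergence-freeness, the bound `|w| ≤ 1`, the Oseen equation, and survival of a
gradient-active centre. [cite: KochNadirashviliSereginSverak2009, §1 (1.2) (arXiv:0709.3599 p. 2)] -/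
theorem stub_activeWindowsZoomTools :
    (∀ (ν T M t₀ k : ℝ), 0 < ν → 0 < M →
      Icc (t₀ - k * ν / M ^ 2) (t₀ + k * ν / M ^ 2) ⊆ Ioo 0 T →
      ∀ s ∈ Ioo (-k) k, t₀ + ν / M ^ 2 * s ∈ Ioo 0 T) ∧
    (∀ (ν T M t₀ k : ℝ) (u : ℝ → EuclideanSpace ℝ (Fin 3) → EuclideanSpace ℝ (Fin 3)) (p : ℝ → EuclideanSpace ℝ (Fin 3) → ℝ) (x₀ : EuclideanSpace ℝ (Fin 3)), 0 < ν →
      IsClassicalNSSolutionOn (Ico 0 T) ν 0 u p → 0 < M →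
      Icc (t₀ - k * ν / M ^ 2) (t₀ + k * ν / M ^ 2) ⊆ Ioo 0 T →
      ContinuousOn (uncurry (M⁻¹ • stPull (ν / M ^ 2) (ν / M) t₀ x₀ u)) (Ioo (-k) k ×ˢ univ)) ∧
    (∀ (ν T M t₀ k : ℝ) (u : ℝ → EuclideanSpace ℝ (Fin 3) → EuclideanSpace ℝ (Fin 3)) (p : ℝ → EuclideanSpace ℝ (Fin 3) → ℝ) (x₀ : EuclideanSpace ℝ (Fin 3)), 0 < ν →
      IsClassicalNSSolutionOn (Ico 0 T) ν 0 u p → 0 < M →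
      Icc (t₀ - k * ν / M ^ 2) (t₀ + k * ν / M ^ 2) ⊆ Ioo 0 T →
      ∀ s ∈ Ioo (-k) k, IsWeaklyDivFree ((M⁻¹ • stPull (ν / M ^ 2) (ν / M) t₀ x₀ u) s)) ∧
    (∀ (ν M t₀ k : ℝ) (u : ℝ → EuclideanSpace ℝ (Fin 3) → EuclideanSpace ℝ (Fin 3)) (x₀ : EuclideanSpace ℝ (Fin 3)), 0 < ν → 0 < M →
      (∀ t ∈ Icc (t₀ - k * ν / M ^ 2) (t₀ + k * ν / M ^ 2), ∀ x, ‖u t x‖ ≤ M) →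
      ∀ s ∈ Ioo (-k) k, ∀ y : EuclideanSpace ℝ (Fin 3), ‖(M⁻¹ • stPull (ν / M ^ 2) (ν / M) t₀ x₀ u) s y‖ ≤ 1) ∧
    (∀ (ν T M t₀ : ℝ) (u : ℝ → EuclideanSpace ℝ (Fin 3) → EuclideanSpace ℝ (Fin 3)) (p : ℝ → EuclideanSpace ℝ (Fin 3) → ℝ) (x₀ : EuclideanSpace ℝ (Fin 3)), 0 < ν → 0 < T →
      IsClassicalNSSolutionOn (Ico 0 T) ν 0 u p → IsLerayHopfOn T ν 0 (u 0) u →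
      HasRapidSpatialDecay (u 0) → 0 < M → ∀ σ τ : ℝ, 0 < t₀ + ν / M ^ 2 * σ → σ < τ →
      t₀ + ν / M ^ 2 * τ < T → ∀ y : EuclideanSpace ℝ (Fin 3),
      (M⁻¹ • stPull (ν / M ^ 2) (ν / M) t₀ x₀ u) τ y =
        UnboundedOperators.heatExtension ((M⁻¹ • stPull (ν / M ^ 2) (ν / M) t₀ x₀ u) σ) (τ - σ) y -
          oseenDuhamel 1 σ (M⁻¹ • stPull (ν / M ^ 2) (ν / M) t₀ x₀ u)
            (M⁻¹ • stPull (ν / M ^ 2) (ν / M) t₀ x₀ u) τ y) ∧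
    (∀ (ν M t₀ ε : ℝ) (u : ℝ → EuclideanSpace ℝ (Fin 3) → EuclideanSpace ℝ (Fin 3)) (x₀ : EuclideanSpace ℝ (Fin 3)), 0 < ν → 0 < M → Differentiable ℝ (u t₀) →
      ε * M ^ 2 ≤ ν * ‖fderiv ℝ (u t₀) x₀‖ →
      ε ≤ ‖fderiv ℝ ((M⁻¹ • stPull (ν / M ^ 2) (ν / M) t₀ x₀ u) 0) 0‖) :=
  ⟨fun _ _ _ _ _ hν hM hsub _ hs => windowZoom_time_mem hν hM hsub hs,
    fun _ _ _ _ _ _ _ _ hν hsol hM hsub => windowZoom_continuousOn hν hsol hM hsub,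
    fun _ _ _ _ _ _ _ _ hν hsol hM hsub _ hs => windowZoom_isWeaklyDivFree hν hsol hM hsub hs,
    fun _ _ _ _ _ _ hν hM hbd _ hs y => windowZoom_norm_le_one hν hM hbd hs y,
    fun _ _ _ _ _ _ _ hν hT hsol hLH h₀ hM _ _ hσ hστ hτ y =>
      windowZoom_oseen hν hT hsol hLH h₀ hM hσ hστ hτ y,
    fun _ _ _ _ _ _ hν hM hd hact => le_norm_fderiv_windowZoom_zero hν hM hd hact⟩

end Summit.NavierStokesRegularity.NavierStokesRegularity.Theorems.TypeIliouvilleNoTypeII.ImmortalZoom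

end
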